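import Summits.AtomisticToContinuum.HydrodynamicLimit.Theorems.ImplosionDichotomyDenseExcursionKidderKnob
import Literature.Analysis.FluidPDE.CompressibleEulerExactSelfSimilarImplosion

/-!
# The `(P, U, Q)` profile equations in vector form on `ℝ³` (line `kidder-knob-melnikov`, stub `stub_memberCore`)

Helper file (`--supports stmt-AtomisticToContinuum-12586`) for the registered stub
`stub_memberCore : HsEulerConeLocality → ProjectiveCovariance → MemberCore` of the crux
`Summit.AtomisticToContinuum.HydrodynamicLimit.Theses.ImplosionDichotomy.DenseExcursion`.

The field `KnobFamily.profileODE` records the three reduced self-similar equations of the FULL ideal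
monatomic system (continuity, radial momentum with `p = ρθ`, temperature with `e = 3θ/2`) for the radial
profiles `Pf, Uf, Qf` at `ζ > 0`:
`3(1−1/r)P + (ζ/r + U)P′ + P(U′ + 2U/ζ) = 0`, `(1−1/r)U + (ζ/r + U)U′ + Q′ + Q P′/P = 0`,
`2(1−1/r)Q + (ζ/r + U)Q′ + (2/3)Q(U′ + 2U/ζ) = 0`.
Here they are lifted to the radial FIELDS `P̄(y) = Pf(|y|)`, `Ū(y) = Uf(|y|) y/|y|`, `Q̄(y) = Qf(|y|)` on all
of `ℝ³` (Mathlib `fderiv` / `gradient`; at `y = 0` by continuity of the residual, exactly as the tree's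
`CaolaboraEtAl2025.profileEq_velocity` does for the isentropic `(U, S)` profile):

* `profileEq_P` : `3(1−1/r)P̄ + DP̄(y/r + Ū) + P̄ div Ū = 0`;
* `profileEq_U` : `P̄((1−1/r)Ū + DŪ(y/r + Ū)) + Q̄ ∇P̄ + P̄ ∇Q̄ = 0`;
* `profileEq_Q` : `2(1−1/r)Q̄ + DQ̄(y/r + Ū) + (2/3)Q̄ div Ū = 0`;
* `memberCore_profileEqs` : the three together, from the clauses `smoothProfile`, `profilePos`, `profileODE`
  of a `KnobFamily` (stated over the bare profile data, so that no `KnobFamily` is needed to use it).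

These are the stationary self-similar equations whose time-dependent dressing (the ansatz of
`KnobFamily.selfSimilar`) solves `AthermalEulerAt 1` (sibling file `…MemberCoreReference.lean`).
-/

noncomputable section

open Set Filter Topology InnerProductSpace
open scoped ContDiff RealInnerProductSpace

namespace Summit.AtomisticToContinuum.HydrodynamicLimit.Theorems.KidderKnobMelnikov

open Literature.MathematicalPhysics.KineticTheory (V3)
open Literature.Analysis.FluidPDE.CaolaboraEtAl2025 (hasFDerivAt_radialScalar hasGradientAt_radialScalar
  hasFDerivAt_radialField trace_fderiv_radialField contDiffAt_profile_of_radialField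
  contDiffAt_profile_of_radialScalar)

namespace MemberCoreProof

variable {r : ℝ} {Pf Uf Qf : ℝ → ℝ}

/-! ## Away from the origin: the radial ODEs are the vector equations -/

/-- **Reduced continuity equation in vector form, `y ≠ 0`.** [folklore] -/
theorem profileEq_P_of_ne_zero {y : V3} (hy : y ≠ 0) {P' U' : ℝ}
    (hPd : HasDerivAt Pf P' ‖y‖) (hUd : HasDerivAt Uf U' ‖y‖)
    (h₁ : 3 * (1 - 1 / r) * Pf ‖y‖ + (‖y‖ / r + Uf ‖y‖) * P' + Pf ‖y‖ * (U' + 2 * Uf ‖y‖ / ‖y‖) = 0) :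
    3 * (1 - 1 / r) * Pf ‖y‖ +
        fderiv ℝ (fun z : V3 => Pf ‖z‖) y ((1 / r) • y + (Uf ‖y‖ / ‖y‖) • y) +
      Pf ‖y‖ * ∑ i, (fderiv ℝ (fun z : V3 => (Uf ‖z‖ / ‖z‖) • z) y (EuclideanSpace.single i 1)) i = 0 := by
  have hn : ‖y‖ ≠ 0 := norm_ne_zero_iff.2 hy
  rw [(hasFDerivAt_radialField hy hUd).fderiv, (hasFDerivAt_radialScalar hy hPd).fderiv,
    trace_fderiv_radialField, ← add_smul, map_smul]
  simp only [smul_apply, innerSL_apply_apply, real_inner_self_eq_norm_sq, smul_eq_mul]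
  field_simp
  field_simp at h₁
  linear_combination h₁

/-- **Reduced radial momentum equation (`p = ρθ`) in vector form, `y ≠ 0`.** [folklore] -/
theorem profileEq_U_of_ne_zero {y : V3} (hy : y ≠ 0) {P' U' Q' : ℝ}
    (hPd : HasDerivAt Pf P' ‖y‖) (hUd : HasDerivAt Uf U' ‖y‖) (hQd : HasDerivAt Qf Q' ‖y‖)
    (hP0 : Pf ‖y‖ ≠ 0)
    (h₂ : (1 - 1 / r) * Uf ‖y‖ + (‖y‖ / r + Uf ‖y‖) * U' + Q' + Qf ‖y‖ * P' / Pf ‖y‖ = 0) :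
    Pf ‖y‖ • ((1 - 1 / r) • ((Uf ‖y‖ / ‖y‖) • y) +
        fderiv ℝ (fun z : V3 => (Uf ‖z‖ / ‖z‖) • z) y ((1 / r) • y + (Uf ‖y‖ / ‖y‖) • y)) +
      Qf ‖y‖ • gradient (fun z : V3 => Pf ‖z‖) y + Pf ‖y‖ • gradient (fun z : V3 => Qf ‖z‖) y = 0 := by
  have hn : ‖y‖ ≠ 0 := norm_ne_zero_iff.2 hy
  rw [(hasFDerivAt_radialField hy hUd).fderiv, (hasGradientAt_radialScalar hy hPd).gradient,
    (hasGradientAt_radialScalar hy hQd).gradient, ← add_smul, map_smul]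
  simp only [add_apply, smul_apply, ContinuousLinearMap.id_apply, ContinuousLinearMap.smulRight_apply,
    innerSL_apply_apply, real_inner_self_eq_norm_sq, smul_eq_mul, smul_smul, ← add_smul]
  refine smul_eq_zero.mpr (Or.inl ?_)
  field_simp
  field_simp at h₂
  linear_combination ‖y‖ * h₂

/-- **Reduced temperature equation (`e = 3θ/2`) in vector form, `y ≠ 0`.** [folklore] -/
theorem profileEq_Q_of_ne_zero {y : V3} (hy : y ≠ 0) {U' Q' : ℝ}
    (hUd : HasDerivAt Uf U' ‖y‖) (hQd : HasDerivAt Qf Q' ‖y‖)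
    (h₃ : 2 * (1 - 1 / r) * Qf ‖y‖ + (‖y‖ / r + Uf ‖y‖) * Q' +
      2 / 3 * Qf ‖y‖ * (U' + 2 * Uf ‖y‖ / ‖y‖) = 0) :
    2 * (1 - 1 / r) * Qf ‖y‖ +
        fderiv ℝ (fun z : V3 => Qf ‖z‖) y ((1 / r) • y + (Uf ‖y‖ / ‖y‖) • y) +
      2 / 3 * Qf ‖y‖ * ∑ i, (fderiv ℝ (fun z : V3 => (Uf ‖z‖ / ‖z‖) • z) y
        (EuclideanSpace.single i 1)) i = 0 := by
  have hn : ‖y‖ ≠ 0 := norm_ne_zero_iff.2 hy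
  rw [(hasFDerivAt_radialField hy hUd).fderiv, (hasFDerivAt_radialScalar hy hQd).fderiv,
    trace_fderiv_radialField, ← add_smul, map_smul]
  simp only [smul_apply, innerSL_apply_apply, real_inner_self_eq_norm_sq, smul_eq_mul]
  field_simp
  field_simp at h₃
  linear_combination h₃

/-! ## On all of `ℝ³`: continuity of the residuals -/

/-- A continuous residual on `ℝ³` vanishing off the origin vanishes everywhere. [folklore] -/
theorem eq_zero_of_forall_ne_zero {E : Type*} [NormedAddCommGroup E] {R : V3 → E} (hc : Continuous R)
    (h : ∀ z : V3, z ≠ 0 → R z = 0) (y : V3) : R y = 0 := by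
  have hRz : R = 0 := by
    haveI : NeBot (𝓝[≠] (0 : V3)) := Module.punctured_nhds_neBot ℝ V3 0
    exact Continuous.ext_on (dense_compl_singleton 0) hc continuous_const fun z hz => h z hz
  exact congrFun hRz y

/-- The coordinate trace `y ↦ ∑ᵢ (DŪ(y) eᵢ)ᵢ` of a smooth field is continuous. [folklore] -/
theorem continuous_trace_fderiv (hU : ContDiff ℝ ∞ fun y : V3 => (Uf ‖y‖ / ‖y‖) • y) :
    Continuous fun y : V3 =>
      ∑ i, (fderiv ℝ (fun z : V3 => (Uf ‖z‖ / ‖z‖) • z) y (EuclideanSpace.single i 1)) i := by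
  refine continuous_finsetSum _ fun i _ => ?_
  exact (PiLp.continuous_apply 2 (fun _ : Fin 3 => ℝ) i).comp
    ((hU.continuous_fderiv (by simp)).clm_apply continuous_const)

/-- The similarity drift `y ↦ y/r + Ū(y)` is continuous. [folklore] -/
theorem continuous_drift (hU : ContDiff ℝ ∞ fun y : V3 => (Uf ‖y‖ / ‖y‖) • y) :
    Continuous fun y : V3 => (1 / r) • y + (Uf ‖y‖ / ‖y‖) • y :=
  ((continuous_const (y := (1 / r : ℝ))).smul continuous_id).add hU.continuous

variable (hP : ContDiff ℝ ∞ fun y : V3 => Pf ‖y‖) (hU : ContDiff ℝ ∞ fun y : V3 => (Uf ‖y‖ / ‖y‖) • y)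
  (hQ : ContDiff ℝ ∞ fun y : V3 => Qf ‖y‖) (hpos : ∀ ζ, 0 ≤ ζ → 0 < Pf ζ)
  (hode : ∀ ζ, 0 < ζ →
    3 * (1 - 1 / r) * Pf ζ + (ζ / r + Uf ζ) * deriv Pf ζ + Pf ζ * (deriv Uf ζ + 2 * Uf ζ / ζ) = 0 ∧
    (1 - 1 / r) * Uf ζ + (ζ / r + Uf ζ) * deriv Uf ζ + deriv Qf ζ + Qf ζ * deriv Pf ζ / Pf ζ = 0 ∧
    2 * (1 - 1 / r) * Qf ζ + (ζ / r + Uf ζ) * deriv Qf ζ +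
      2 / 3 * Qf ζ * (deriv Uf ζ + 2 * Uf ζ / ζ) = 0)
include hU hode

include hP in
/-- **Reduced continuity equation on all of `ℝ³`.** [folklore] -/
theorem profileEq_P (y : V3) :
    3 * (1 - 1 / r) * Pf ‖y‖ +
        fderiv ℝ (fun z : V3 => Pf ‖z‖) y ((1 / r) • y + (Uf ‖y‖ / ‖y‖) • y) +
      Pf ‖y‖ * ∑ i, (fderiv ℝ (fun z : V3 => (Uf ‖z‖ / ‖z‖) • z) y (EuclideanSpace.single i 1)) i = 0 := by
  have hc : Continuous fun y : V3 => 3 * (1 - 1 / r) * Pf ‖y‖ +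
        fderiv ℝ (fun z : V3 => Pf ‖z‖) y ((1 / r) • y + (Uf ‖y‖ / ‖y‖) • y) +
      Pf ‖y‖ * ∑ i, (fderiv ℝ (fun z : V3 => (Uf ‖z‖ / ‖z‖) • z) y (EuclideanSpace.single i 1)) i :=
    ((continuous_const.mul hP.continuous).add
      ((hP.continuous_fderiv (by simp)).clm_apply (continuous_drift hU))).add
      (hP.continuous.mul (continuous_trace_fderiv hU))
  refine eq_zero_of_forall_ne_zero hc (fun z hz => ?_) y
  have hζ : 0 < ‖z‖ := norm_pos_iff.mpr hz
  have hUd := ((contDiffAt_profile_of_radialField hU hζ).differentiableAt (by simp)).hasDerivAt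
  have hPd := ((contDiffAt_profile_of_radialScalar hP hζ).differentiableAt (by simp)).hasDerivAt
  exact profileEq_P_of_ne_zero hz hPd hUd (hode ‖z‖ hζ).1

include hQ in
/-- **Reduced temperature equation on all of `ℝ³`.** [folklore] -/
theorem profileEq_Q (y : V3) :
    2 * (1 - 1 / r) * Qf ‖y‖ +
        fderiv ℝ (fun z : V3 => Qf ‖z‖) y ((1 / r) • y + (Uf ‖y‖ / ‖y‖) • y) +
      2 / 3 * Qf ‖y‖ * ∑ i, (fderiv ℝ (fun z : V3 => (Uf ‖z‖ / ‖z‖) • z) y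
        (EuclideanSpace.single i 1)) i = 0 := by
  have hc : Continuous fun y : V3 => 2 * (1 - 1 / r) * Qf ‖y‖ +
        fderiv ℝ (fun z : V3 => Qf ‖z‖) y ((1 / r) • y + (Uf ‖y‖ / ‖y‖) • y) +
      2 / 3 * Qf ‖y‖ * ∑ i, (fderiv ℝ (fun z : V3 => (Uf ‖z‖ / ‖z‖) • z) y
        (EuclideanSpace.single i 1)) i :=
    ((continuous_const.mul hQ.continuous).add
      ((hQ.continuous_fderiv (by simp)).clm_apply (continuous_drift hU))).add
      ((continuous_const.mul hQ.continuous).mul (continuous_trace_fderiv hU))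
  refine eq_zero_of_forall_ne_zero hc (fun z hz => ?_) y
  have hζ : 0 < ‖z‖ := norm_pos_iff.mpr hz
  have hUd := ((contDiffAt_profile_of_radialField hU hζ).differentiableAt (by simp)).hasDerivAt
  have hQd := ((contDiffAt_profile_of_radialScalar hQ hζ).differentiableAt (by simp)).hasDerivAt
  exact profileEq_Q_of_ne_zero hz hUd hQd (hode ‖z‖ hζ).2.2

include hP hQ hpos in
/-- **Reduced radial momentum equation on all of `ℝ³`.** [folklore] -/
theorem profileEq_U (y : V3) :
    Pf ‖y‖ • ((1 - 1 / r) • ((Uf ‖y‖ / ‖y‖) • y) +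
        fderiv ℝ (fun z : V3 => (Uf ‖z‖ / ‖z‖) • z) y ((1 / r) • y + (Uf ‖y‖ / ‖y‖) • y)) +
      Qf ‖y‖ • gradient (fun z : V3 => Pf ‖z‖) y + Pf ‖y‖ • gradient (fun z : V3 => Qf ‖z‖) y = 0 := by
  have h1 : Continuous (fderiv ℝ fun z : V3 => (Uf ‖z‖ / ‖z‖) • z) := hU.continuous_fderiv (by simp)
  have h2 : Continuous fun y => gradient (fun z : V3 => Pf ‖z‖) y :=
    (toDual ℝ V3).symm.continuous.comp (hP.continuous_fderiv (by simp))
  have h3 : Continuous fun y => gradient (fun z : V3 => Qf ‖z‖) y :=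
    (toDual ℝ V3).symm.continuous.comp (hQ.continuous_fderiv (by simp))
  have h4 : Continuous fun y : V3 => (1 - 1 / r) • ((Uf ‖y‖ / ‖y‖) • y) :=
    (continuous_const (y := (1 - 1 / r : ℝ))).smul hU.continuous
  have hc : Continuous fun y : V3 => Pf ‖y‖ • ((1 - 1 / r) • ((Uf ‖y‖ / ‖y‖) • y) +
        fderiv ℝ (fun z : V3 => (Uf ‖z‖ / ‖z‖) • z) y ((1 / r) • y + (Uf ‖y‖ / ‖y‖) • y)) +
      Qf ‖y‖ • gradient (fun z : V3 => Pf ‖z‖) y + Pf ‖y‖ • gradient (fun z : V3 => Qf ‖z‖) y :=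
    ((hP.continuous.smul (h4.add (h1.clm_apply (continuous_drift hU)))).add
      (hQ.continuous.smul h2)).add (hP.continuous.smul h3)
  refine eq_zero_of_forall_ne_zero hc (fun z hz => ?_) y
  have hζ : 0 < ‖z‖ := norm_pos_iff.mpr hz
  have hUd := ((contDiffAt_profile_of_radialField hU hζ).differentiableAt (by simp)).hasDerivAt
  have hPd := ((contDiffAt_profile_of_radialScalar hP hζ).differentiableAt (by simp)).hasDerivAt
  have hQd := ((contDiffAt_profile_of_radialScalar hQ hζ).differentiableAt (by simp)).hasDerivAt
  exact profileEq_U_of_ne_zero hz hPd hUd hQd (hpos ‖z‖ hζ.le).ne' (hode ‖z‖ hζ).2.1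

end MemberCoreProof

open MemberCoreProof in
/-- **The three reduced self-similar equations of the full ideal monatomic system, in vector form on all
of `ℝ³`.** For radial profiles `Pf, Uf, Qf` smooth as fields on `ℝ³`, `Pf > 0` on `[0, ∞)`, solving the
reduced ODEs of `KnobFamily.profileODE` for `ζ > 0`, the fields `P̄ = Pf(|·|)`, `Ū = Uf(|·|)·/|·|`,
`Q̄ = Qf(|·|)` satisfy, at EVERY `y ∈ ℝ³` (with `V = y/r + Ū(y)` the similarity drift and
`div Ū = ∑ᵢ (DŪ eᵢ)ᵢ`): `3(1−1/r)P̄ + DP̄(V) + P̄ div Ū = 0`,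
`P̄((1−1/r)Ū + DŪ(V)) + Q̄∇P̄ + P̄∇Q̄ = 0`, `2(1−1/r)Q̄ + DQ̄(V) + (2/3)Q̄ div Ū = 0`. [folklore] -/
theorem memberCore_profileEqs : ∀ (r : ℝ) (Pf Uf Qf : ℝ → ℝ),
    ContDiff ℝ ∞ (fun y : V3 => Pf ‖y‖) → ContDiff ℝ ∞ (fun y : V3 => (Uf ‖y‖ / ‖y‖) • y) →
    ContDiff ℝ ∞ (fun y : V3 => Qf ‖y‖) → (∀ ζ, 0 ≤ ζ → 0 < Pf ζ) →
    (∀ ζ, 0 < ζ →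
      3 * (1 - 1 / r) * Pf ζ + (ζ / r + Uf ζ) * deriv Pf ζ + Pf ζ * (deriv Uf ζ + 2 * Uf ζ / ζ) = 0 ∧
      (1 - 1 / r) * Uf ζ + (ζ / r + Uf ζ) * deriv Uf ζ + deriv Qf ζ + Qf ζ * deriv Pf ζ / Pf ζ = 0 ∧
      2 * (1 - 1 / r) * Qf ζ + (ζ / r + Uf ζ) * deriv Qf ζ +
        2 / 3 * Qf ζ * (deriv Uf ζ + 2 * Uf ζ / ζ) = 0) →
    ∀ y : V3,
      (3 * (1 - 1 / r) * Pf ‖y‖ +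
          fderiv ℝ (fun z : V3 => Pf ‖z‖) y ((1 / r) • y + (Uf ‖y‖ / ‖y‖) • y) +
        Pf ‖y‖ * ∑ i, (fderiv ℝ (fun z : V3 => (Uf ‖z‖ / ‖z‖) • z) y (EuclideanSpace.single i 1)) i = 0) ∧
      (Pf ‖y‖ • ((1 - 1 / r) • ((Uf ‖y‖ / ‖y‖) • y) +
          fderiv ℝ (fun z : V3 => (Uf ‖z‖ / ‖z‖) • z) y ((1 / r) • y + (Uf ‖y‖ / ‖y‖) • y)) +
        Qf ‖y‖ • gradient (fun z : V3 => Pf ‖z‖) y + Pf ‖y‖ • gradient (fun z : V3 => Qf ‖z‖) y = 0) ∧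
      (2 * (1 - 1 / r) * Qf ‖y‖ +
          fderiv ℝ (fun z : V3 => Qf ‖z‖) y ((1 / r) • y + (Uf ‖y‖ / ‖y‖) • y) +
        2 / 3 * Qf ‖y‖ * ∑ i, (fderiv ℝ (fun z : V3 => (Uf ‖z‖ / ‖z‖) • z) y
          (EuclideanSpace.single i 1)) i = 0) :=
  fun _ _ _ _ hP hU hQ hpos hode y =>
    ⟨profileEq_P (hP := hP) (hU := hU) (hode := hode) y,
      profileEq_U (hP := hP) (hU := hU) (hQ := hQ) (hpos := hpos) (hode := hode) y,
      profileEq_Q (hU := hU) (hQ := hQ) (hode := hode) y⟩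

end Summit.AtomisticToContinuum.HydrodynamicLimit.Theorems.KidderKnobMelnikov

end
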